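import Summits.BirchSwinnertonDyer.Rank1Residual.Additive.GordTorsionAnomalousThree
import Summits.BirchSwinnertonDyer.Rank1Residual.Additive.ReductionPointCountIsogeny
import Summits.BirchSwinnertonDyer.Rank1Residual.Additive.GordIsogenyInvariance
import HarnessLib

/-!
# THE TORSION EXCEPTION IS ANOMALOUS AT EVERY ODD `p`: on the whole (G)-cell a `ℚ_p`-rational
# `p`-torsion point forces `¬ ReductionNonAnomalous W p`, and `ReductionNonAnomalous W p ⟹ t = 0`
# — uniformly in `p ≥ 3`, curve by curve and isogeny class by isogeny class

HONEST FRAMING (cell `b2b-bsdres`, run/shared/lean/b2b/bsd-rank1-residual/, verbatim in every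
file): the goal of the cell is to DELETE the COMBINATION-SHAPED residual classes of the
Birch–Swinnerton-Dyer formula for ALL analytic-rank `≤ 1` elliptic curves over `ℚ` — "full BSD
formula for every rank `≤ 1` curve in class `C`" assembled STRICTLY from published theorems — so
that the rank-`≤ 1` remainder becomes exactly the CONSTRUCTION-SHAPED classes, which are TYPED
(missing-input `Prop`s), NOT attempted. This is not "finishing BSD". Sub-cell `additive-p2`
(X3♯(G-ord) / X4♯(G-ord)), generation 39: research route; no claim beyond the stated classes;
theorems only (joins of generation 38 at `p ≥ 5` and generation 39 at `p = 3`), no definition, no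
named fact, nothing booked, no label moved.

## What

Generation 38 (`Additive/GordTorsionAnomalous` (+ `…Class`); `p ≥ 5`, cusp jets of `ψ₅`, `ψ₇`) and
generation 39 (`Additive/GordTorsionAnomalousThree`; `p = 3`, the good twist `E^{(−3)}` and `ψ₃`)
are joined into statements quantified over every ODD prime `p`:

* **`TypeG.not_reductionNonAnomalous_of_prime_zsmul_eq_zero_odd`**: (G), `E` additive at `p ≠ 2`,
  `P ∈ E(ℚ_p)`, `P ≠ O`, `p • P = O` ⟹ `¬ ReductionNonAnomalous W p`;
* **`TypeG.padicValNat_torsionOrder_eq_zero_of_reductionNonAnomalous_odd`** (and the local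
  `E(ℚ_p)[p] = 0`): the proviso of Delbourgo (B) clause 3 that makes `ℓ = 1` kills the torsion
  term `2t` on the WHOLE (G)-cell at EVERY odd `p` — the two per-pair provisos of every exact
  leading-term statement of the sub-cell (generations 18–38) are ONE;
* the isogeny-CLASS forms (`…_of_isIsogenous_…_odd`; generation 38's
  `reductionNonAnomalous_iff_of_isIsogenous`, Faltings): a `p`-torsion point on ANY member makes the
  class anomalous, and a non-anomalous (G)-class is `p`-torsion-free member by member;
* the X3♯(G-ord) / X4♯(G-ord) class forms (X4 has `p ≠ 2` built in).

Census reading (EVIDENCE, generations 37–38, zero compute): window N < 2·10⁴ — at `p ≥ 5`, 13/13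
(G-ord) classes with a `p`-torsion member are anomalous over `F₀`; at `p = 3`, 214/214.

References: [Delbourgo2002] D. Delbourgo, J. Number Theory 95 (2002), p. 39 (`ℓ_p(E)`), Thm (B);
[Delbourgo1998] §1.5; [Mazur1977] Ch. III §5, Step 1, p. 158; [Mazur1972] §1;
[Faltings1983Endlichkeit] §5 Korollar 2.
-/

noncomputable section

open scoped Classical NumberField

namespace Summit.BirchSwinnertonDyer.Rank1Residual.Additive

open WeierstrassCurve IsDedekindDomain NumberField Literature.NumberTheory.EllipticCurves
  Literature.NumberTheory.EllipticCurves.Rank1Residual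

section Curve

variable {W : WeierstrassCurve ℚ} [W.IsElliptic] [W.IsGloballyMinimal] {p : ℕ} [hp : Fact p.Prime]

/-- **(G), `E` additive at an ODD prime `p`, and a `ℚ_p`-point `P ≠ O` with `p • P = O` ⟹ the
reduction over the (G)-field is ANOMALOUS** (`p = 3`: generation 39; `p ≥ 5`: generation 38).
[cite: Delbourgo2002, p. 39 (definition of ℓ_p(E)); Mazur1977, Ch. III §5, Step 1, p. 158 (method)] -/
theorem TypeG.not_reductionNonAnomalous_of_prime_zsmul_eq_zero_odd (hG : TypeG W p) (hp2 : p ≠ 2)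
    (hadd : Addv W p) {P : (W.baseChange ℚ_[p]).toAffine.Point} (hP0 : P ≠ 0)
    (hP : (p : ℤ) • P = 0) : ¬ Delbourgo2002.ReductionNonAnomalous W p := by
  by_cases h3 : p = 3
  · subst h3
    exact hG.not_reductionNonAnomalous_three_of_prime_zsmul_eq_zero hadd hP0 (by exact_mod_cast hP)
  · exact hG.not_reductionNonAnomalous_of_prime_zsmul_eq_zero
      (hp.out.five_le_of_ne_two_of_ne_three hp2 h3) hadd hP0 hP

/-- **On the (G)-cell at every odd `p`, `ReductionNonAnomalous W p ⟹ E(ℚ_p)[p] = 0`.**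
[cite: Delbourgo2002, p. 39 (definition of ℓ_p(E)); Mazur1977, Ch. III §5, Step 1, p. 158 (method)] -/
theorem TypeG.eq_zero_of_prime_nsmul_eq_zero_of_reductionNonAnomalous_odd (hG : TypeG W p)
    (hp2 : p ≠ 2) (hadd : Addv W p) (hR : Delbourgo2002.ReductionNonAnomalous W p)
    {P : (W.baseChange ℚ_[p]).toAffine.Point} (hP : p • P = 0) : P = 0 := by
  by_contra hP0
  exact hG.not_reductionNonAnomalous_of_prime_zsmul_eq_zero_odd hp2 hadd hP0
    (by rw [natCast_zsmul]; exact hP) hR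

/-- **On the (G)-cell at every odd `p`, `ReductionNonAnomalous W p ⟹ E(ℚ)[p] = 0`.**
[cite: Delbourgo2002, p. 39 (definition of ℓ_p(E)); Mazur1977, Ch. III §5, Step 1, p. 158 (method)] -/
theorem TypeG.eq_zero_of_prime_zsmul_eq_zero_rat_of_reductionNonAnomalous_odd (hG : TypeG W p)
    (hp2 : p ≠ 2) (hadd : Addv W p) (hR : Delbourgo2002.ReductionNonAnomalous W p)
    {P : W.toAffine.Point} (hP : (p : ℤ) • P = 0) : P = 0 := by
  have hinj : Function.Injective (W.toPadicPoint p) :=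
    Affine.Point.map_injective (W' := W) (Algebra.ofId ℚ ℚ_[p])
  apply hinj
  rw [map_zero]
  exact hG.eq_zero_of_prime_nsmul_eq_zero_of_reductionNonAnomalous_odd hp2 hadd hR
    (by rw [← natCast_zsmul, ← map_zsmul, hP, map_zero])

/-- **On the (G)-cell at every odd `p`, `ReductionNonAnomalous W p ⟹ p ∤ #E(ℚ)_tors`.**
[cite: Delbourgo2002, p. 39 (definition of ℓ_p(E)); Mazur1977, Ch. III §5, Step 1, p. 158 (method)] -/
theorem TypeG.not_dvd_torsionOrder_of_reductionNonAnomalous_odd (hG : TypeG W p) (hp2 : p ≠ 2)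
    (hadd : Addv W p) (hR : Delbourgo2002.ReductionNonAnomalous W p) : ¬ p ∣ W.torsionOrder :=
  not_dvd_torsionOrder_of_noPTorsion W p
    (fun _ hQ => hG.eq_zero_of_prime_nsmul_eq_zero_of_reductionNonAnomalous_odd hp2 hadd hR hQ)

/-- **On the (G)-cell at every odd `p`, `ReductionNonAnomalous W p ⟹ t = ord_p #E(ℚ)_tors = 0`**:
the two per-pair provisos of Delbourgo (B) clause 3 (`ℓ = 1`; the torsion term) are ONE on the whole
(G)-cell. [cite: Delbourgo2002, p. 39 (definition of ℓ_p(E)) and Theorem (B) (p. 40); Mazur1977, Ch. III §5, Step 1, p. 158 (method)] -/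
theorem TypeG.padicValNat_torsionOrder_eq_zero_of_reductionNonAnomalous_odd (hG : TypeG W p)
    (hp2 : p ≠ 2) (hadd : Addv W p) (hR : Delbourgo2002.ReductionNonAnomalous W p) :
    padicValNat p W.torsionOrder = 0 :=
  padicValNat.eq_zero_of_not_dvd (hG.not_dvd_torsionOrder_of_reductionNonAnomalous_odd hp2 hadd hR)

/-- (G)-ordinary form: **`TypeGOrd ∧ Addv ∧ ReductionNonAnomalous ⟹ t = 0`** at every odd `p`.
[cite: Delbourgo2002, p. 39 (definition of ℓ_p(E)); Delbourgo1998, §1.5] -/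
theorem TypeGOrd.padicValNat_torsionOrder_eq_zero_of_reductionNonAnomalous_odd (hG : TypeGOrd W p)
    (hp2 : p ≠ 2) (hadd : Addv W p) (hR : Delbourgo2002.ReductionNonAnomalous W p) :
    padicValNat p W.torsionOrder = 0 :=
  hG.typeG.padicValNat_torsionOrder_eq_zero_of_reductionNonAnomalous_odd hp2 hadd hR

/-- **X3♯(G-ord) at an odd `p`, off the anomalous rows: `t = ord_p #E(ℚ)_tors = 0`.**
[cite: Delbourgo2002, p. 39 (definition of ℓ_p(E)); Delbourgo1998, §1.5] -/
theorem ClassX3Gord.padicValNat_torsionOrder_eq_zero_of_reductionNonAnomalous_odd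
    (hX : ClassX3Gord W p) (hp2 : p ≠ 2) (hR : Delbourgo2002.ReductionNonAnomalous W p) :
    padicValNat p W.torsionOrder = 0 :=
  hX.2.typeG.padicValNat_torsionOrder_eq_zero_of_reductionNonAnomalous_odd hp2 hX.1.2 hR

/-- **X3♯(G-ord) at an odd `p`, off the anomalous rows: `E(ℚ_p)[p] = 0`.**
[cite: Delbourgo2002, p. 39 (definition of ℓ_p(E)); Delbourgo1998, §1.5] -/
theorem ClassX3Gord.eq_zero_of_prime_nsmul_eq_zero_of_reductionNonAnomalous_odd
    (hX : ClassX3Gord W p) (hp2 : p ≠ 2) (hR : Delbourgo2002.ReductionNonAnomalous W p)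
    {P : (W.baseChange ℚ_[p]).toAffine.Point} (hP : p • P = 0) : P = 0 :=
  hX.2.typeG.eq_zero_of_prime_nsmul_eq_zero_of_reductionNonAnomalous_odd hp2 hX.1.2 hR hP

/-- **X4♯(G-ord) (any `p` of the class — X4 has `p ≠ 2` built in), off the anomalous rows:
`t = 0`.** [cite: Delbourgo2002, p. 39 (definition of ℓ_p(E)); Delbourgo1998, §1.5] -/
theorem ClassX4Gord.padicValNat_torsionOrder_eq_zero_of_reductionNonAnomalous_odd
    (hX : ClassX4Gord W p) (hR : Delbourgo2002.ReductionNonAnomalous W p) :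
    padicValNat p W.torsionOrder = 0 :=
  hX.2.typeG.padicValNat_torsionOrder_eq_zero_of_reductionNonAnomalous_odd hX.1.1 hX.1.2.1 hR

/-- **X4♯(G-ord), off the anomalous rows: `E(ℚ_p)[p] = 0`.**
[cite: Delbourgo2002, p. 39 (definition of ℓ_p(E)); Delbourgo1998, §1.5] -/
theorem ClassX4Gord.eq_zero_of_prime_nsmul_eq_zero_of_reductionNonAnomalous_odd
    (hX : ClassX4Gord W p) (hR : Delbourgo2002.ReductionNonAnomalous W p)
    {P : (W.baseChange ℚ_[p]).toAffine.Point} (hP : p • P = 0) : P = 0 :=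
  hX.2.typeG.eq_zero_of_prime_nsmul_eq_zero_of_reductionNonAnomalous_odd hX.1.1 hX.1.2.1 hR hP

/-- **X3♯(G-ord) at an odd `p`: a `ℚ_p`-point `P ≠ O` with `p • P = O` ⟹ the row is anomalous.**
[cite: Delbourgo2002, p. 39 (definition of ℓ_p(E)); Delbourgo1998, §1.5] -/
theorem ClassX3Gord.not_reductionNonAnomalous_of_prime_zsmul_eq_zero_odd (hX : ClassX3Gord W p)
    (hp2 : p ≠ 2) {P : (W.baseChange ℚ_[p]).toAffine.Point} (hP0 : P ≠ 0) (hP : (p : ℤ) • P = 0) :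
    ¬ Delbourgo2002.ReductionNonAnomalous W p :=
  hX.2.typeG.not_reductionNonAnomalous_of_prime_zsmul_eq_zero_odd hp2 hX.1.2 hP0 hP

/-- **X4♯(G-ord): a `ℚ_p`-point `P ≠ O` with `p • P = O` ⟹ the row is anomalous.**
[cite: Delbourgo2002, p. 39 (definition of ℓ_p(E)); Delbourgo1998, §1.5] -/
theorem ClassX4Gord.not_reductionNonAnomalous_of_prime_zsmul_eq_zero_odd (hX : ClassX4Gord W p)
    {P : (W.baseChange ℚ_[p]).toAffine.Point} (hP0 : P ≠ 0) (hP : (p : ℤ) • P = 0) :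
    ¬ Delbourgo2002.ReductionNonAnomalous W p :=
  hX.2.typeG.not_reductionNonAnomalous_of_prime_zsmul_eq_zero_odd hX.1.1 hX.1.2.1 hP0 hP

end Curve

/-! ## Isogeny-class forms at every odd `p` -/

section Class

variable {W W' : WeierstrassCurve ℚ} [W.IsElliptic] [W'.IsElliptic] [W'.IsGloballyMinimal] {p : ℕ}
  [hp : Fact p.Prime]

/-- **A `p`-torsion point ANYWHERE in the class makes the (G)-class anomalous, every odd `p`**:
`W ∼ W'` over `ℚ`, `TypeG W p`, `Addv W p`, `p ≠ 2`, `P' ∈ W'(ℚ_p)`, `P' ≠ O`, `p • P' = O` ⟹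
`¬ ReductionNonAnomalous W p`. [cite: Delbourgo2002, p. 39 (definition of ℓ_p(E)); Faltings1983Endlichkeit, §5 Korollar 2] -/
theorem TypeG.not_reductionNonAnomalous_of_isIsogenous_of_prime_zsmul_eq_zero_odd
    (h : IsIsogenous W W') (hG : TypeG W p) (hp2 : p ≠ 2) (hadd : Addv W p)
    {P : (W'.baseChange ℚ_[p]).toAffine.Point} (hP0 : P ≠ 0) (hP : (p : ℤ) • P = 0) :
    ¬ Delbourgo2002.ReductionNonAnomalous W p := by
  rw [reductionNonAnomalous_iff_of_isIsogenous p h]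
  exact (hG.of_isIsogenous h).not_reductionNonAnomalous_of_prime_zsmul_eq_zero_odd hp2
    (Addv.of_isIsogenous_of_typeG hadd hG h) hP0 hP

/-- **A non-anomalous (G)-class is `p`-torsion-free member by member, locally, every odd `p`**:
`W ∼ W'`, `TypeG W p`, `Addv W p`, `ReductionNonAnomalous W p` ⟹ `E'(ℚ_p)[p] = 0`.
[cite: Delbourgo2002, p. 39 (definition of ℓ_p(E)); Faltings1983Endlichkeit, §5 Korollar 2] -/
theorem TypeG.eq_zero_of_prime_nsmul_eq_zero_of_isIsogenous_of_reductionNonAnomalous_odd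
    (h : IsIsogenous W W') (hG : TypeG W p) (hp2 : p ≠ 2) (hadd : Addv W p)
    (hR : Delbourgo2002.ReductionNonAnomalous W p) {P : (W'.baseChange ℚ_[p]).toAffine.Point}
    (hP : p • P = 0) : P = 0 := by
  by_contra hP0
  exact hG.not_reductionNonAnomalous_of_isIsogenous_of_prime_zsmul_eq_zero_odd h hp2 hadd hP0
    (by rw [natCast_zsmul]; exact hP) hR

/-- **… and rationally: `p ∤ #E'(ℚ)_tors` for every `E' ∼ E`** in a non-anomalous (G)-class, every
odd `p`. [cite: Delbourgo2002, p. 39 (definition of ℓ_p(E)); Faltings1983Endlichkeit, §5 Korollar 2] -/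
theorem TypeG.padicValNat_torsionOrder_eq_zero_of_isIsogenous_of_reductionNonAnomalous_odd
    (h : IsIsogenous W W') (hG : TypeG W p) (hp2 : p ≠ 2) (hadd : Addv W p)
    (hR : Delbourgo2002.ReductionNonAnomalous W p) : padicValNat p W'.torsionOrder = 0 :=
  padicValNat.eq_zero_of_not_dvd (not_dvd_torsionOrder_of_noPTorsion W' p
    (fun _ hQ => hG.eq_zero_of_prime_nsmul_eq_zero_of_isIsogenous_of_reductionNonAnomalous_odd h
      hp2 hadd hR hQ))

/-- **X3♯(G-ord), class level, every odd `p`**: `W ∼ W'`, `ClassX3Gord W p`, a `ℚ_p`-rational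
`p`-torsion point on `W'` ⟹ the row `(W, p)` is anomalous — at `p = 3` the 214 window classes with
a `3`-torsion member. [cite: Delbourgo2002, p. 39 (definition of ℓ_p(E)); Delbourgo1998, §1.5] -/
theorem ClassX3Gord.not_reductionNonAnomalous_of_isIsogenous_of_prime_zsmul_eq_zero_odd
    (h : IsIsogenous W W') (hX : ClassX3Gord W p) (hp2 : p ≠ 2)
    {P : (W'.baseChange ℚ_[p]).toAffine.Point} (hP0 : P ≠ 0) (hP : (p : ℤ) • P = 0) :
    ¬ Delbourgo2002.ReductionNonAnomalous W p :=
  hX.2.typeG.not_reductionNonAnomalous_of_isIsogenous_of_prime_zsmul_eq_zero_odd h hp2 hX.1.2 hP0 hP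

/-- **X4♯(G-ord), class level**: the same on the irreducible half (`p ≠ 2` is built into X4).
[cite: Delbourgo2002, p. 39 (definition of ℓ_p(E)); Delbourgo1998, §1.5] -/
theorem ClassX4Gord.not_reductionNonAnomalous_of_isIsogenous_of_prime_zsmul_eq_zero_odd
    (h : IsIsogenous W W') (hX : ClassX4Gord W p)
    {P : (W'.baseChange ℚ_[p]).toAffine.Point} (hP0 : P ≠ 0) (hP : (p : ℤ) • P = 0) :
    ¬ Delbourgo2002.ReductionNonAnomalous W p :=
  hX.2.typeG.not_reductionNonAnomalous_of_isIsogenous_of_prime_zsmul_eq_zero_odd h hX.1.1 hX.1.2.1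
    hP0 hP

/-- **X3♯(G-ord) off the anomalous rows, every odd `p`: every curve of the class has
`p ∤ #E'(ℚ)_tors`.** [cite: Delbourgo2002, p. 39 (definition of ℓ_p(E)); Delbourgo1998, §1.5] -/
theorem ClassX3Gord.padicValNat_torsionOrder_eq_zero_of_isIsogenous_of_reductionNonAnomalous_odd
    (h : IsIsogenous W W') (hX : ClassX3Gord W p) (hp2 : p ≠ 2)
    (hR : Delbourgo2002.ReductionNonAnomalous W p) : padicValNat p W'.torsionOrder = 0 :=
  hX.2.typeG.padicValNat_torsionOrder_eq_zero_of_isIsogenous_of_reductionNonAnomalous_odd h hp2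
    hX.1.2 hR

/-- **X4♯(G-ord) off the anomalous rows: every curve of the class has `p ∤ #E'(ℚ)_tors`.**
[cite: Delbourgo2002, p. 39 (definition of ℓ_p(E)); Delbourgo1998, §1.5] -/
theorem ClassX4Gord.padicValNat_torsionOrder_eq_zero_of_isIsogenous_of_reductionNonAnomalous_odd
    (h : IsIsogenous W W') (hX : ClassX4Gord W p) (hR : Delbourgo2002.ReductionNonAnomalous W p) :
    padicValNat p W'.torsionOrder = 0 :=
  hX.2.typeG.padicValNat_torsionOrder_eq_zero_of_isIsogenous_of_reductionNonAnomalous_odd h hX.1.1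
    hX.1.2.1 hR

end Class

end Summit.BirchSwinnertonDyer.Rank1Residual.Additive

end
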